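/-
Origin: expansion seat `planner-pub-hodgecm-pv14-g6-0`, handover import Pv14g6.SchwartzMultiplierDeriv -> import HodgeCM.Automorphic.SchwartzMultiplierDeriv ; after SchwartzMultiplierDeriv (this seat row 8, same run) (`HOME/pub-hodgecm-pv14-g6/lean/Pv14g6/SchwartzTranslationDeriv.lean`, md5 c0d541a0, 131 lines);
landed by the gen-8 packager in gate run 30 as `HodgeCM/Automorphic/SchwartzTranslationDeriv.lean` (import ^import Pv14g6\.SchwartzMultiplierDeriv[ \t]*$→import HodgeCM.Automorphic.SchwartzMultiplierDeriv ×1).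
-/
/-
Copyright (c) 2026. All rights reserved.
Released under Apache 2.0 license as described in the file LICENSE.
Origin: pub-hodgecm-pv14-g6 (DAG-node prover #14, gen 6), file #11; target
`HodgeCM/Automorphic/SchwartzTranslationDeriv.lean` (namespace `HodgeCM.SchwartzWeil`).  NEW ADDITIVE LEAF.
-/
import Summits.HodgeConjecture.HodgeCM.Automorphic.SchwartzMultiplierDeriv
import Summits.HodgeConjecture.HodgeCM.Automorphic.WeilThetaModelHeisenberg_2
import Mathlib.Analysis.Distribution.SchwartzSpace.Fourier

/-!
# The translation group and the Schrödinger representation are differentiable on Schwartz space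

Fourier-conjugating the modulation result of `SchwartzMultiplierDeriv` (`τ_{a} = 𝓕⁻ ∘ M_{-a} ∘ 𝓕`,
`HodgeCM.SchwartzWeil.fourierInv_modCLM`) and using Mathlib's `∂_{a} (𝓕⁻ Ψ) = 𝓕⁻ (2πi⟪·, a⟫ Ψ)`
(`SchwartzMap.lineDerivOp_fourierInv_eq`) we obtain, in the SCHWARTZ TOPOLOGY of `𝓢(V, ℂ)`:

* `tendsto_compSubConstCLM_smul_sub_div` — **translations**: `s⁻¹ (Φ(· - s a) - Φ) ⟶ -∂_{a} Φ`;
* `hasDerivAt_compSubConstCLM_smul` — the vector-valued form through any continuous `ℝ`-linear `T`;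
* `tendsto_repCLM_transl_sub_div`, `tendsto_repCLM_modul_sub_div` — the weight-`m` **Schrödinger
  representation** `ρ_m` (`HodgeCM.SchwartzWeil.repCLM`) is differentiable at the identity along the
  one-parameter subgroups `s ↦ (s a, 0, 1)` and `s ↦ (0, s b, 1)` of `Heis V` on every Schwartz vector, with
  generators `-∂_{a}` and `2πi m ⟪b, ·⟫`.

Not here: higher derivatives, joint smoothness in the group variable, the full Lie-algebra (Weyl-algebra)
representation.
-/

noncomputable section

open scoped Real FourierTransform SchwartzMap RealInnerProductSpace Topology LineDeriv
open Complex Filter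

namespace HodgeCM
namespace SchwartzWeil

variable (V : Type) [NormedAddCommGroup V] [InnerProductSpace ℝ V] [FiniteDimensional ℝ V]
  [MeasurableSpace V] [BorelSpace V]

/-- `τ_{s a} = 𝓕⁻ ∘ M_{s(-a)} ∘ 𝓕` on `𝓢(V, ℂ)`. -/
theorem compSubConstCLM_smul_eq (a : V) (s : ℝ) (Φ : 𝓢(V, ℂ)) :
    SchwartzMap.compSubConstCLM ℂ (s • a) Φ = 𝓕⁻ (modCLM V (s • (-a)) (𝓕 Φ)) := by
  rw [fourierInv_modCLM, smul_neg, neg_neg, FourierTransform.fourierInv_fourier_eq]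

omit [FiniteDimensional ℝ V] [MeasurableSpace V] [BorelSpace V] in
/-- (Ported verbatim from the HodgeCMPerL package; no docstring in the source.) -/
theorem smulLeftCLM_inner_neg_eq (a : V) (Ψ : 𝓢(V, ℂ)) :
    SchwartzMap.smulLeftCLM ℂ (fun x : V => 2 * π * I * ((⟪-a, x⟫ : ℝ) : ℂ)) Ψ =
      -((2 * π * I) • SchwartzMap.smulLeftCLM ℂ (inner ℝ · a) Ψ) := by
  have h1 : (fun x : V => 2 * π * I * ((⟪-a, x⟫ : ℝ) : ℂ)).HasTemperateGrowth := by fun_prop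
  have h2 : (inner ℝ · a : V → ℝ).HasTemperateGrowth := by fun_prop
  ext x
  rw [neg_apply, smul_apply, SchwartzMap.smulLeftCLM_apply_apply h1, SchwartzMap.smulLeftCLM_apply_apply h2,
    inner_neg_left, real_inner_comm, smul_eq_mul, smul_eq_mul, Complex.real_smul]
  push_cast
  ring

/-- **The translation group is differentiable on Schwartz functions**:
`s⁻¹ (τ_{s a} Φ - Φ) ⟶ -∂_{a} Φ` in `𝓢(V, ℂ)` as `s → 0`, `s ≠ 0` (`τ_{c} Φ = Φ(· - c)`). -/
theorem tendsto_compSubConstCLM_smul_sub_div (a : V) (Φ : 𝓢(V, ℂ)) :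
    Tendsto (fun s : ℝ => s⁻¹ • (SchwartzMap.compSubConstCLM ℂ (s • a) Φ - Φ)) (𝓝[≠] 0)
      (𝓝 (-∂_{a} Φ)) := by
  set T := (FourierTransform.fourierInvCLM ℂ 𝓢(V, ℂ)).restrictScalars ℝ with hT
  have hTapp : ∀ Ψ : 𝓢(V, ℂ), T Ψ = 𝓕⁻ Ψ := fun Ψ => rfl
  have h := (T.continuous.tendsto _).comp (tendsto_modCLM_smul_sub_div V (-a) (𝓕 Φ))
  have hlim : T (SchwartzMap.smulLeftCLM ℂ (fun x : V => 2 * π * I * ((⟪-a, x⟫ : ℝ) : ℂ)) (𝓕 Φ)) =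
      -∂_{a} Φ := by
    rw [smulLeftCLM_inner_neg_eq, map_neg, hTapp, ← SchwartzMap.lineDerivOp_fourierInv_eq,
      FourierTransform.fourierInv_fourier_eq]
  rw [← hlim]
  refine h.congr' (Eventually.of_forall fun s => ?_)
  simp only [Function.comp_apply]
  rw [map_smul, map_sub, hTapp, hTapp, ← compSubConstCLM_smul_eq, FourierTransform.fourierInv_fourier_eq]

omit [FiniteDimensional ℝ V] [MeasurableSpace V] [BorelSpace V] in
/-- (Ported verbatim from the HodgeCMPerL package; no docstring in the source.) -/
theorem compSubConstCLM_zero_apply (Φ : 𝓢(V, ℂ)) : SchwartzMap.compSubConstCLM ℂ (0 : V) Φ = Φ := by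
  ext x; simp

/-- Vector-valued form: `s ↦ T (τ_{s a} Φ)` has derivative `T (-∂_{a} Φ)` at `0` for every continuous
`ℝ`-linear `T`. -/
theorem hasDerivAt_compSubConstCLM_smul {F : Type*} [NormedAddCommGroup F] [NormedSpace ℝ F] (a : V)
    (Φ : 𝓢(V, ℂ)) (T : 𝓢(V, ℂ) →L[ℝ] F) :
    HasDerivAt (fun s : ℝ => T (SchwartzMap.compSubConstCLM ℂ (s • a) Φ)) (T (-∂_{a} Φ)) 0 := by
  rw [hasDerivAt_iff_tendsto_slope_zero]
  have h := (T.continuous.tendsto _).comp (tendsto_compSubConstCLM_smul_sub_div V a Φ)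
  refine h.congr' (Eventually.of_forall fun t => ?_)
  simp only [Function.comp_apply, zero_add, zero_smul, compSubConstCLM_zero_apply, map_smul, map_sub]

/-! ## The Schrödinger representation along one-parameter subgroups -/

variable (m : ℤ)

/-- `ρ_m(a, 0, 1) = τ_{a}`. -/
theorem repCLM_transl (a : V) : repCLM V m ⟨a, 0, 1⟩ = SchwartzMap.compSubConstCLM ℂ a := by
  ext Φ x
  simp [repCLM_apply]

/-- `ρ_m(0, b, 1) = M_{m b}`. -/
theorem repCLM_modul (b : V) : repCLM V m ⟨0, b, 1⟩ = modCLM V ((m : ℝ) • b) := by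
  ext Φ x
  simp [repCLM_apply]

/-- **`ρ_m` is differentiable along `s ↦ (s a, 0, 1)`** on every Schwartz vector, with generator `-∂_{a}`. -/
theorem tendsto_repCLM_transl_sub_div (a : V) (Φ : 𝓢(V, ℂ)) :
    Tendsto (fun s : ℝ => s⁻¹ • (repCLM V m ⟨s • a, 0, 1⟩ Φ - Φ)) (𝓝[≠] 0) (𝓝 (-∂_{a} Φ)) := by
  simp_rw [repCLM_transl]
  exact tendsto_compSubConstCLM_smul_sub_div V a Φ

/-- **`ρ_m` is differentiable along `s ↦ (0, s b, 1)`** on every Schwartz vector, with generator the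
multiplication by `2πi m ⟪b, ·⟫`. -/
theorem tendsto_repCLM_modul_sub_div (b : V) (Φ : 𝓢(V, ℂ)) :
    Tendsto (fun s : ℝ => s⁻¹ • (repCLM V m ⟨0, s • b, 1⟩ Φ - Φ)) (𝓝[≠] 0)
      (𝓝 (SchwartzMap.smulLeftCLM ℂ (fun x : V => 2 * π * I * ((⟪(m : ℝ) • b, x⟫ : ℝ) : ℂ)) Φ)) := by
  simp_rw [repCLM_modul, smul_comm (m : ℝ)]
  exact tendsto_modCLM_smul_sub_div V ((m : ℝ) • b) Φ

/-- Vector-valued forms for `ρ_m`. -/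
theorem hasDerivAt_repCLM_transl {F : Type*} [NormedAddCommGroup F] [NormedSpace ℝ F] (a : V)
    (Φ : 𝓢(V, ℂ)) (T : 𝓢(V, ℂ) →L[ℝ] F) :
    HasDerivAt (fun s : ℝ => T (repCLM V m ⟨s • a, 0, 1⟩ Φ)) (T (-∂_{a} Φ)) 0 := by
  simp_rw [repCLM_transl]
  exact hasDerivAt_compSubConstCLM_smul V a Φ T

/-- (Ported verbatim from the HodgeCMPerL package; no docstring in the source.) -/
theorem hasDerivAt_repCLM_modul {F : Type*} [NormedAddCommGroup F] [NormedSpace ℝ F] (b : V)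
    (Φ : 𝓢(V, ℂ)) (T : 𝓢(V, ℂ) →L[ℝ] F) :
    HasDerivAt (fun s : ℝ => T (repCLM V m ⟨0, s • b, 1⟩ Φ))
      (T (SchwartzMap.smulLeftCLM ℂ (fun x : V => 2 * π * I * ((⟪(m : ℝ) • b, x⟫ : ℝ) : ℂ)) Φ)) 0 := by
  simp_rw [repCLM_modul, smul_comm (m : ℝ), modCLM_smul_eq_smulLeftCLM]
  exact hasDerivAt_smulLeftCLM_fourierChar (Function.hasTemperateGrowth_inner_right ((m : ℝ) • b)) Φ T

end SchwartzWeil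
end HodgeCM
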